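import Mathlib
import Summits.CriticalPhenomena.CardyFormulaZ2.Theorems.CardySelfRefinementDefs
import Summits.CriticalPhenomena.CardyFormulaZ2.Theorems.CardySelfRefinementRussoDriftPolynomial
import Summits.CriticalPhenomena.CardyFormulaZ2.Theorems.CardySelfRefinementTrivialSectorRateStubSixArmSectorMassFactorisation
import Literature.Probability.LatticeModels.ProdBernoulliReimer
import HarnessLib

/-!
# Stub `stub_sixArmDecay` of line `far-field-is-a-quarter-turn` (crux `TrivialSectorRate`,
stmt-CriticalPhenomena-10266): REIMER'S INEQUALITY FOR `M_k` WITH BUNDLE-DISJOINT WITNESSES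

The price of the sixth arm (input (S6) of `sixArmDecayAlong_of_fiveArm`) is, in print, Reimer's
inequality `P(𝒜₆) ≤ P(𝒜₅ □ 𝒜₁) ≤ P(𝒜₅) P(𝒜₁)` for the product measure `P_p`.  The self-refinement
law `M_k(ρ,c) = (coin product law).map (cfg k)` is NOT a product measure on bond configurations:
the `k` collinear sub-edges of a coarse edge read a common shared coin and a common selector, so two
EDGE-disjoint witness sets are not COIN-disjoint when they contain different sub-edges of one bundle,
and `M_k(A □ B) ≤ M_k(A) M_k(B)` fails in general.  What does hold is Reimer's inequality on the
coin space (`prodBernoulli_reimer_local`, arbitrary local events under an inhomogeneous product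
Bernoulli law) pulled back through the read-out: disjoint occurrence with witnesses whose COIN
WINDOWS are disjoint ("bundle-disjoint", e.g. `k`-separated in sup-distance) is sub-multiplicative.

* `preimage_cfg_setOf_coinDisjoint_subset` — the event "`A` and `B` occur on edge witnesses `K`, `L`
  reading disjoint coin sets" pulls back into `(cfg k ⁻¹' A) □ (cfg k ⁻¹' B)` on the coin space
  (`cfg_inter_eq_of_agree`: coins agreeing on `coinWindow k K` give configurations agreeing on `K`);
* `isLocalEvent_preimage_cfg` — pull-backs of edge-local events are coin-local
  (`determinedBy_preimage_cfg`, `coinWindow_finite`);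
* `M_real_le_mul_of_preimage_subset_disjointOccurrence` — `M_k(E) ≤ M_k(A) · M_k(B)` whenever
  `cfg k ⁻¹' E ⊆ (cfg k ⁻¹' A) □ (cfg k ⁻¹' B)`, for measurable `E` and measurable edge-local `A`, `B`;
* **`M_real_le_mul_of_coinDisjoint_witnesses`** (registered helper of the stub) — **Reimer for
  `M_k` with bundle-disjoint witnesses**: if every LATTICE configuration of `E` carries edge witness
  sets `K`, `L` for `A`, `B` with `Disjoint (coinWindow k K) (coinWindow k L)`, then
  `M_k(ρ,c₀)(E) ≤ M_k(ρ,c₀)(A) · M_k(ρ,c₀)(B)`;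
* `disjoint_coinWindow_of_far` — a geometric criterion: edge sets at sup-distance `≥ k` (all
  endpoints) read disjoint coin sets (`tb_eq_of_mem_coinsOf`, `abs_sub_lt_of_tb_eq`).

Target file:
`Summits/CriticalPhenomena/CardyFormulaZ2/Theorems/CardySelfRefinementTrivialSectorRateStubSixArmDecayReimer.lean`.
-/

noncomputable section


namespace Summit.CriticalPhenomena.CardyFormulaZ2.Theorems.CardySelfRefinement.FarField

open Set MeasureTheory
open Literature.Probability.LatticeModels Literature.Probability.Percolation
open Literature.Probability.Percolation.QuadCrossing
open Summit.CriticalPhenomena.CardyFormulaZ2.Theses.CardySelfRefinement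

/-! ### Coin-disjoint edge witnesses pull back to disjoint occurrence on the coin space -/

/-- Coins agreeing with `S` on the coin window of `K` produce a configuration agreeing with
`cfg k S` on `K`: the coin cylinder over `coinWindow k K` maps into the edge cylinder over `K`. -/
theorem cfg_mem_localCylinder_of_agree (k : ℕ) {K : Set (Sym2 (Site 2))} {S T : Set Coin}
    (h : T ∈ localCylinder (coinWindow k K) S) : cfg k T ∈ localCylinder K (cfg k S) := by
  intro e he
  have hKe := Set.ext_iff.1 (cfg_inter_eq_of_agree k (W := K) (S := T) (S' := S) h) e
  simp only [mem_inter_iff, he, and_true] at hKe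
  exact hKe

/-- **Bundle-disjoint witnesses are coin-disjoint witnesses**: the event that `A` and `B` occur on
edge witness sets `K`, `L` reading DISJOINT COIN SETS pulls back, through the read-out `cfg k`,
into the disjoint occurrence `(cfg k ⁻¹' A) □ (cfg k ⁻¹' B)` on the coin space (witnesses
`coinWindow k K`, `coinWindow k L`). -/
theorem preimage_cfg_setOf_coinDisjoint_subset (k : ℕ) (A B : Set (BondConfig (Site 2))) :
    cfg k ⁻¹' {ω | ∃ K L : Set (Sym2 (Site 2)), Disjoint (coinWindow k K) (coinWindow k L) ∧
        localCylinder K ω ⊆ A ∧ localCylinder L ω ⊆ B} ⊆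
      disjointOccurrence (cfg k ⁻¹' A) (cfg k ⁻¹' B) := by
  rintro S ⟨K, L, hKL, hKA, hLB⟩
  exact ⟨coinWindow k K, coinWindow k L, hKL,
    fun T hT => hKA (cfg_mem_localCylinder_of_agree k hT),
    fun T hT => hLB (cfg_mem_localCylinder_of_agree k hT)⟩

/-- Pull-backs through `cfg k` of events determined by finitely many edges are local events of the
coin space. -/
theorem isLocalEvent_preimage_cfg (k : ℕ) {A : Set (BondConfig (Site 2))} {W : Set (Sym2 (Site 2))}
    (hW : W.Finite) (hA : DeterminedBy A W) : IsLocalEvent (cfg k ⁻¹' A) := by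
  refine ⟨(coinWindow_finite k hW).toFinset, ?_⟩
  rw [Set.Finite.coe_toFinset]
  exact determinedBy_preimage_cfg k hA

/-! ### Reimer's inequality for `M_k` -/

/-- **Reimer's inequality for `M_k`, coin form**: if the pull-back of a measurable event `E` lies in
the coin-space disjoint occurrence of the pull-backs of two measurable edge-local events `A`, `B`,
then `M_k(ρ,c₀)(E) ≤ M_k(ρ,c₀)(A) · M_k(ρ,c₀)(B)` (`prodBernoulli_reimer_local` on the coin law). -/
theorem M_real_le_mul_of_preimage_subset_disjointOccurrence (k : ℕ) (ρ c₀ : ℝ)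
    {E A B : Set (BondConfig (Site 2))} (hE : MeasurableSet E) (hA : MeasurableSet A)
    (hB : MeasurableSet B) {WA WB : Set (Sym2 (Site 2))} (hWA : WA.Finite) (hWB : WB.Finite)
    (hAW : DeterminedBy A WA) (hBW : DeterminedBy B WB)
    (h : cfg k ⁻¹' E ⊆ disjointOccurrence (cfg k ⁻¹' A) (cfg k ⁻¹' B)) :
    (M k ρ c₀).real E ≤ (M k ρ c₀).real A * (M k ρ c₀).real B := by
  rw [map_measureReal_apply (measurable_cfg k) hE, map_measureReal_apply (measurable_cfg k) hA,
    map_measureReal_apply (measurable_cfg k) hB]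
  exact (measureReal_mono h (measure_ne_top _ _)).trans
    (prodBernoulli_reimer_local (prm k ρ c₀) (isLocalEvent_preimage_cfg k hWA hAW)
      (isLocalEvent_preimage_cfg k hWB hBW))

/-- **REIMER'S INEQUALITY FOR `M_k` WITH BUNDLE-DISJOINT WITNESSES** (registered helper of the stub
`stub_sixArmDecay`).  Let `A`, `B` be measurable events determined by finite edge sets and `E` a
measurable event such that every LATTICE configuration `ω ∈ E` (`ω ⊆ E(ℤ²)`; `M_k` is carried by
them) admits edge witness sets `K`, `L` — the cylinder of `ω` over `K` lies in `A`, that over `L` in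
`B` — whose COIN WINDOWS (`coinWindow`: own coin, shared coin and selector of the bundle of each
edge) are disjoint, e.g. `K`, `L` at sup-distance `≥ k` (`disjoint_coinWindow_of_far`).  Then
`M_k(ρ,c₀)(E) ≤ M_k(ρ,c₀)(A) · M_k(ρ,c₀)(B)`.  (With merely edge-disjoint `K`, `L` this fails for
`ρ > 0`: the axial sub-edges of one bundle are positively correlated.) -/
theorem M_real_le_mul_of_coinDisjoint_witnesses (k : ℕ) (ρ c₀ : ℝ)
    {E A B : Set (BondConfig (Site 2))} (hE : MeasurableSet E) (hA : MeasurableSet A)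
    (hB : MeasurableSet B) {WA WB : Set (Sym2 (Site 2))} (hWA : WA.Finite) (hWB : WB.Finite)
    (hAW : DeterminedBy A WA) (hBW : DeterminedBy B WB)
    (h : ∀ ω ∈ E, ω ⊆ (zdGraph 2).edgeSet → ∃ K L : Set (Sym2 (Site 2)),
      Disjoint (coinWindow k K) (coinWindow k L) ∧ localCylinder K ω ⊆ A ∧ localCylinder L ω ⊆ B) :
    (M k ρ c₀).real E ≤ (M k ρ c₀).real A * (M k ρ c₀).real B := by
  refine M_real_le_mul_of_preimage_subset_disjointOccurrence k ρ c₀ hE hA hB hWA hWB hAW hBW ?_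
  refine Set.Subset.trans (fun S hS => ?_) (preimage_cfg_setOf_coinDisjoint_subset k A B)
  exact h (cfg k S) hS (cfg_subset_edgeSet k S)

/-! ### A geometric criterion for coin-disjointness -/

/-- **Edge sets at sup-distance `≥ k` read disjoint coin sets** (`0 < k`): if every endpoint of
every pair of `K` is at sup-distance at least `k` from every endpoint of every pair of `L`, then
`coinWindow k K` and `coinWindow k L` are disjoint — two fine edges reading a common coin have the
same coarse base, hence base points at sup-distance `< k` (`tb_eq_of_mem_coinsOf`,
`abs_sub_lt_of_tb_eq`). -/
theorem disjoint_coinWindow_of_far {k : ℕ} (hk : 0 < k) {K L : Set (Sym2 (Site 2))}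
    (h : ∀ e ∈ K, ∀ e' ∈ L, ∀ w ∈ e, ∀ w' ∈ e', ∃ j : Fin 2, (k : ℤ) ≤ |w j - w' j|) :
    Disjoint (coinWindow k K) (coinWindow k L) := by
  rw [Set.disjoint_left]
  intro i hiK hiL
  obtain ⟨vd, hvd, hi⟩ := Set.mem_iUnion₂.1 hiK
  obtain ⟨vd', hvd', hi'⟩ := Set.mem_iUnion₂.1 hiL
  obtain ⟨-, htb⟩ := tb_eq_of_mem_coinsOf k hi hi'
  obtain ⟨j, hj⟩ := h (edgeOf vd) hvd (edgeOf vd') hvd' vd.1 (Sym2.mem_mk_left _ _) vd'.1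
    (Sym2.mem_mk_left _ _)
  obtain ⟨h1, h2⟩ := abs_sub_lt_of_tb_eq hk htb j
  have : |vd.1 j - vd'.1 j| < k := abs_sub_lt_iff.2 ⟨h1, h2⟩
  exact absurd hj (not_le.2 this)

end Summit.CriticalPhenomena.CardyFormulaZ2.Theorems.CardySelfRefinement.FarField

end
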